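import Mathlib
import Summits.Ventures.PercRepro2.TypedStarConn
import Summits.Ventures.PercRepro2.TypedHat

/-!
# ONE UNMARKED STAR VERTEX OVER AN ALL-MARKED BASE, II: THE TYPED `K₃` BASE AS A SUM OF MASKED `K₅`
COUNTS (blind cell PercRepro2, p2 g2, 2026-08-25; sub-claim S1 (C) of ASSIGNMENTS v12.61)

With `conn_iff_star` (TypedStarConn.lean) the kernel `K₃` of `G` at a star placement is the kernel of
`K₅` at the masked patterns (`K3_star`), and splitting the three star edges off (`typedCount_split3`)
the typed `K₃` base of `G` is the sum, over the placements of the star edges in the three copies, of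
typer-1's hyperedge-augmented typed counts of `K₅` (`typedCount_K3_star`; `starSum` = the
27-placement sum of `typedCountHyper` of K5HyperTheorem.lean, written out).

* **`StarNonneg R o a₁ a₂ a₃ b p₁ p₂ p₃ t₁ t₂ t₃`** — row 2′TRI on `K₅ + u` (marks `o, …, b ∈ Fin 5`,
  `u` adjacent to `p₁, p₂, p₃` with types `t₁, t₂, t₃`), stated as the nonnegativity of the placement
  sum for every typed set of mark pairs and every type map on `K₅` — the statement typer-1's
  Kronecker certificates prove (one certificate per `(marking, T, type vector)`);
* **`typedCount_K3_nonneg_of_starNonneg`** — row 2′TRI on every typed graph with ONE unmarked vertex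
  `u` of typed degree `3` over an all-marked base, from `StarNonneg` at the image marking.

Own code; standard axioms; nothing here is a certificate — `StarNonneg` is a hypothesis.
-/

namespace Summit.Ventures.PercRepro2

open Hub

namespace K5

/-! ## The kernel `K₃` at a star placement -/

section Kernel

variable {V : Type*} {E : Type*} [Fintype E] [DecidableEq E] [DecidableEq V]
variable (m : V → Fin 5) (ends : E → Sym2 V) (F₀ : Finset E) {M : Set V}
variable {R : Type*} [Field R]

variable {m ends F₀}

omit [Fintype E] [DecidableEq V] in
/-- The connection indicator at a star placement. -/
lemma indicator_connEvent_star (hinj : Set.InjOn m M) (hM : ∀ e ∈ F₀, ∀ v ∈ ends e, v ∈ M)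
    (hloop : ∀ e ∈ F₀, ¬ (ends e).IsDiag) {u v₁ v₂ v₃ : V} {e₁ e₂ e₃ : E}
    (hd : StarData ends M u v₁ v₂ v₃ e₁ e₂ e₃) {x : Config E} (hx : ClosedOff F₀ x) (s₁ s₂ s₃ : Bool)
    {p q : V} (hp : p ∈ M) (hq : q ∈ M) :
    (connEvent ends p q).indicator (1 : Config E → R) (starUpd e₁ e₂ e₃ s₁ s₂ s₃ x) =
      (connEvent ends5 (m p) (m q)).indicator (1 : Config (Fin 10) → R)
        (orOn (starMask (m v₁) (m v₂) (m v₃) s₁ s₂ s₃) (patternM m ends F₀ x)) := by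
  refine indicator_eq_of_iff ?_
  rw [mem_connEvent, mem_connEvent]
  exact conn_iff_star m ends F₀ hinj hM hloop hd.hu hd.hv₁ hd.hv₂ hd.hv₃ hd.h1 hd.h2 hd.h3 hd.h12 hd.h13
    hd.h23 hx s₁ s₂ s₃ hp hq

omit [Fintype E] [DecidableEq V] in
/-- The indicator of `Q` at a star placement. -/
lemma indicator_avoidAll_star (hinj : Set.InjOn m M) (hM : ∀ e ∈ F₀, ∀ v ∈ ends e, v ∈ M)
    (hloop : ∀ e ∈ F₀, ¬ (ends e).IsDiag) {u v₁ v₂ v₃ : V} {e₁ e₂ e₃ : E}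
    (hd : StarData ends M u v₁ v₂ v₃ e₁ e₂ e₃) {x : Config E} (hx : ClosedOff F₀ x) (s₁ s₂ s₃ : Bool)
    {a₁ a₂ : V} (ha₁ : a₁ ∈ M) (ha₂ : a₂ ∈ M) :
    (avoidAll ends a₂ {a₁}).indicator (1 : Config E → R) (starUpd e₁ e₂ e₃ s₁ s₂ s₃ x) =
      (avoidAll ends5 (m a₂) {m a₁}).indicator (1 : Config (Fin 10) → R)
        (orOn (starMask (m v₁) (m v₂) (m v₃) s₁ s₂ s₃) (patternM m ends F₀ x)) := by
  refine indicator_eq_of_iff ?_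
  simp only [mem_avoidAll, Finset.mem_singleton, forall_eq]
  rw [conn_iff_star m ends F₀ hinj hM hloop hd.hu hd.hv₁ hd.hv₂ hd.hv₃ hd.h1 hd.h2 hd.h3 hd.h12 hd.h13
    hd.h23 hx s₁ s₂ s₃ ha₂ ha₁]

omit [Fintype E] [DecidableEq V] in
/-- The indicator of `PD` at a star placement. -/
lemma indicator_PDEvent_star (hinj : Set.InjOn m M) (hM : ∀ e ∈ F₀, ∀ v ∈ ends e, v ∈ M)
    (hloop : ∀ e ∈ F₀, ¬ (ends e).IsDiag) {u v₁ v₂ v₃ : V} {e₁ e₂ e₃ : E}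
    (hd : StarData ends M u v₁ v₂ v₃ e₁ e₂ e₃) {x : Config E} (hx : ClosedOff F₀ x) (s₁ s₂ s₃ : Bool)
    {a₁ a₂ a₃ : V} (ha₁ : a₁ ∈ M) (ha₂ : a₂ ∈ M) (ha₃ : a₃ ∈ M) :
    (PDEvent ends a₁ a₂ a₃).indicator (1 : Config E → R) (starUpd e₁ e₂ e₃ s₁ s₂ s₃ x) =
      (PDEvent ends5 (m a₁) (m a₂) (m a₃)).indicator (1 : Config (Fin 10) → R)
        (orOn (starMask (m v₁) (m v₂) (m v₃) s₁ s₂ s₃) (patternM m ends F₀ x)) := by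
  refine indicator_eq_of_iff ?_
  simp only [PDEvent, Dtilde, UnionCluster.inU, Set.mem_inter_iff, Set.mem_compl_iff, Set.mem_union,
    mem_connEvent]
  have hc := fun {p q : V} (hp : p ∈ M) (hq : q ∈ M) => conn_iff_star m ends F₀ hinj hM hloop hd.hu
    hd.hv₁ hd.hv₂ hd.hv₃ hd.h1 hd.h2 hd.h3 hd.h12 hd.h13 hd.h23 hx s₁ s₂ s₃ hp hq
  rw [hc ha₁ ha₂, hc ha₃ ha₁, hc ha₃ ha₂]

omit [Fintype E] [DecidableEq V] in
/-- **The kernel `K₃` of `G` at a star placement is the kernel of `K₅` at the masked patterns.** -/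
theorem K3_star (hinj : Set.InjOn m M) (hM : ∀ e ∈ F₀, ∀ v ∈ ends e, v ∈ M)
    (hloop : ∀ e ∈ F₀, ¬ (ends e).IsDiag) {u v₁ v₂ v₃ : V} {e₁ e₂ e₃ : E}
    (hd : StarData ends M u v₁ v₂ v₃ e₁ e₂ e₃) {o a₁ a₂ a₃ b : V} (ho : o ∈ M) (ha₁ : a₁ ∈ M)
    (ha₂ : a₂ ∈ M) (ha₃ : a₃ ∈ M) (hb : b ∈ M) {x y w : Config E} (hx : ClosedOff F₀ x)
    (hy : ClosedOff F₀ y) (hw : ClosedOff F₀ w) (sx₁ sx₂ sx₃ sy₁ sy₂ sy₃ sw₁ sw₂ sw₃ : Bool) :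
    CovForm.K3 (R := R) ends o a₁ a₂ a₃ b (starUpd e₁ e₂ e₃ sx₁ sx₂ sx₃ x)
        (starUpd e₁ e₂ e₃ sy₁ sy₂ sy₃ y) (starUpd e₁ e₂ e₃ sw₁ sw₂ sw₃ w) =
      CovForm.K3 (R := R) ends5 (m o) (m a₁) (m a₂) (m a₃) (m b)
        (orOn (starMask (m v₁) (m v₂) (m v₃) sx₁ sx₂ sx₃) (patternM m ends F₀ x))
        (orOn (starMask (m v₁) (m v₂) (m v₃) sy₁ sy₂ sy₃) (patternM m ends F₀ y))
        (orOn (starMask (m v₁) (m v₂) (m v₃) sw₁ sw₂ sw₃) (patternM m ends F₀ w)) := by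
  unfold CovForm.K3 CovForm.sepKernel CovForm.f3 CovForm.f4 CovForm.f5 CovForm.f6 CovForm.f7 CovForm.f10
    CovForm.f11 CovForm.f12 CovForm.sigma CovForm.inU CovForm.iQ CovForm.iPD CovForm.iL CovForm.iH
  simp only [Fin.sum_univ_succ, Fin.sum_univ_zero, Matrix.cons_val_zero, Matrix.cons_val_succ, add_zero,
    indicator_connEvent_star hinj hM hloop hd hx, indicator_connEvent_star hinj hM hloop hd hy,
    indicator_connEvent_star hinj hM hloop hd hw, indicator_avoidAll_star hinj hM hloop hd hx,
    indicator_avoidAll_star hinj hM hloop hd hy, indicator_avoidAll_star hinj hM hloop hd hw,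
    indicator_PDEvent_star hinj hM hloop hd hx, indicator_PDEvent_star hinj hM hloop hd hy,
    indicator_PDEvent_star hinj hM hloop hd hw, ho, ha₁, ha₂, ha₃, hb]

end Kernel

/-! ## The transfer of the typed base -/

section Transfer

variable {V : Type*} {E : Type*} [Fintype E] [DecidableEq E] [DecidableEq V]
variable {R : Type*} [Field R]

/-- The placement sum of masked typed counts of a kernel `K` on `K₅` at the star `(p₁, p₂, p₃)` with
types `(t₁, t₂, t₃)`: typer-1's `typedCountHyper F z τ S₁ S₂ S₃ K` summed over the placements of the
three star edges (`S_c` = the clique mask of the neighbours open in copy `c`). -/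
noncomputable def starSum (F : Finset (Fin 10)) (z : Config (Fin 10)) (τ : Fin 10 → ℕ)
    (p₁ p₂ p₃ : Fin 5) (t₁ t₂ t₃ : ℕ)
    (K : Config (Fin 10) → Config (Fin 10) → Config (Fin 10) → R) : R :=
  ∑ a : Bool, ∑ b : Bool, ∑ c : Bool, if a.toNat + b.toNat + c.toNat = t₁ then
    (∑ a' : Bool, ∑ b' : Bool, ∑ c' : Bool, if a'.toNat + b'.toNat + c'.toNat = t₂ then
      (∑ a'' : Bool, ∑ b'' : Bool, ∑ c'' : Bool, if a''.toNat + b''.toNat + c''.toNat = t₃ then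
        typedCount F z τ (fun x y w =>
          K (orOn (starMask p₁ p₂ p₃ a a' a'') x) (orOn (starMask p₁ p₂ p₃ b b' b'') y)
            (orOn (starMask p₁ p₂ p₃ c c' c'') w))
      else 0) else 0) else 0

omit [Fintype E] [DecidableEq V] in
/-- The pinning after three splits is still `z ≡ false`. -/
lemma update_false3 (e₁ e₂ e₃ : E) :
    Function.update (Function.update (Function.update (fun _ : E => false) e₁ false) e₂ false) e₃ false =
      fun _ => false := by
  rw [Function.update_eq_self e₁ (fun _ : E => false), Function.update_eq_self e₂ (fun _ : E => false),
    Function.update_eq_self e₃ (fun _ : E => false)]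

omit [DecidableEq V] in
/-- **THE TYPED `K₃` BASE OF A GRAPH WITH ONE UNMARKED STAR VERTEX OVER AN ALL-MARKED BASE IS THE
PLACEMENT SUM OF THE MASKED TYPED COUNTS OF `K₅`** at the pattern minor of the all-marked part, the
star neighbours `m v₁, m v₂, m v₃` and the types of the star edges. -/
theorem typedCount_K3_star (m : V → Fin 5) (ends : E → Sym2 V) (F : Finset E) {M : Set V}
    (hinj : Set.InjOn m M) {u v₁ v₂ v₃ : V} {e₁ e₂ e₃ : E} (hd : StarData ends M u v₁ v₂ v₃ e₁ e₂ e₃)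
    (he₁ : e₁ ∈ F) (he₂ : e₂ ∈ F) (he₃ : e₃ ∈ F)
    (hM : ∀ e ∈ ((F.erase e₁).erase e₂).erase e₃, ∀ v ∈ ends e, v ∈ M)
    (hloop : ∀ e ∈ ((F.erase e₁).erase e₂).erase e₃, ¬ (ends e).IsDiag)
    (hpar : ∀ e ∈ ((F.erase e₁).erase e₂).erase e₃, ∀ e' ∈ ((F.erase e₁).erase e₂).erase e₃,
      ends e = ends e' → e = e')
    {o a₁ a₂ a₃ b : V} (ho : o ∈ M) (ha₁ : a₁ ∈ M) (ha₂ : a₂ ∈ M) (ha₃ : a₃ ∈ M) (hb : b ∈ M)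
    (τ : E → ℕ) :
    typedCount F (fun _ => false) τ (CovForm.K3 (R := R) ends o a₁ a₂ a₃ b) =
      starSum (minorFM m ends (((F.erase e₁).erase e₂).erase e₃)) (fun _ => false)
        (minorτM m ends (((F.erase e₁).erase e₂).erase e₃) τ) (m v₁) (m v₂) (m v₃) (τ e₁) (τ e₂) (τ e₃)
        (CovForm.K3 (R := R) ends5 (m o) (m a₁) (m a₂) (m a₃) (m b)) := by
  set F₀ := ((F.erase e₁).erase e₂).erase e₃ with hF₀
  rw [CovForm.TypedRed.typedCount_split3 F he₁ he₂ he₃ hd.h12 hd.h13 hd.h23, update_false3]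
  unfold starSum
  refine Finset.sum_congr rfl fun a _ => Finset.sum_congr rfl fun b _ =>
    Finset.sum_congr rfl fun c _ => ?_
  by_cases hA : a.toNat + b.toNat + c.toNat = τ e₁
  · rw [if_pos hA, if_pos hA]
    refine Finset.sum_congr rfl fun a' _ => Finset.sum_congr rfl fun b' _ =>
      Finset.sum_congr rfl fun c' _ => ?_
    by_cases hB : a'.toNat + b'.toNat + c'.toNat = τ e₂
    · rw [if_pos hB, if_pos hB]
      refine Finset.sum_congr rfl fun a'' _ => Finset.sum_congr rfl fun b'' _ =>
        Finset.sum_congr rfl fun c'' _ => ?_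
      by_cases hC : a''.toNat + b''.toNat + c''.toNat = τ e₃
      · rw [if_pos hC, if_pos hC, ← typedCount_patternM_eq m ends F₀ hinj hM hloop hpar]
        refine typedCount_congr_closedOff F₀ τ _ _ fun x y w hx hy hw => ?_
        exact K3_star hinj hM hloop hd ho ha₁ ha₂ ha₃ hb hx hy hw a a' a'' b b' b'' c c' c''
      · rw [if_neg hC, if_neg hC]
    · rw [if_neg hB, if_neg hB]
  · rw [if_neg hA, if_neg hA]

end Transfer

/-! ## The star statement on `K₅` and its consequence -/

section Statement

variable (R : Type*) [Field R] [LinearOrder R] [IsStrictOrderedRing R]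

/-- **Row 2′TRI on `K₅ + u`** (the statement typer-1's Kronecker certificates prove): for the marks
`o, a₁, a₂, a₃, b ∈ Fin 5`, the star neighbours `p₁, p₂, p₃` and the types `t₁, t₂, t₃`, the placement
sum of the masked typed counts of `K₃` is nonnegative for every typed set `F` of pairs of MARKS (at a
coincidence marking the fifth vertex of `K₅` is not a mark and carries no typed edge), every edge off
`F` pinned closed, and every type map. -/
def StarNonneg (o a₁ a₂ a₃ b p₁ p₂ p₃ : Fin 5) (t₁ t₂ t₃ : ℕ) : Prop :=
  ∀ (F : Finset (Fin 10)) (τ : Fin 10 → ℕ),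
    (∀ j ∈ F, ∀ v ∈ ends5 j, v = o ∨ v = a₁ ∨ v = a₂ ∨ v = a₃ ∨ v = b) →
    0 ≤ starSum F (fun _ => false) τ p₁ p₂ p₃ t₁ t₂ t₃ (CovForm.K3 (R := R) ends5 o a₁ a₂ a₃ b)

variable {R}

/-- The pairs of the pattern minor join images of marks. -/
lemma minorFM_ends {V : Type*} {E : Type*} [Fintype E] [DecidableEq E] [DecidableEq V]
    (m : V → Fin 5) (ends : E → Sym2 V) (F₀ : Finset E) {M : Set V}
    (hM : ∀ e ∈ F₀, ∀ v ∈ ends e, v ∈ M) {j : Fin 10} (hj : j ∈ minorFM m ends F₀) :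
    ∀ v ∈ ends5 j, ∃ y ∈ M, m y = v := by
  obtain ⟨e, heF, he⟩ := (mem_minorFM m ends F₀).1 hj
  obtain ⟨-, hmap⟩ := (mem_bundleM m ends F₀).1 he
  obtain ⟨y₁, y₂, hy₁, hy₂, hxy⟩ := ends_eq_of_mem ends F₀ hM heF
  intro v hv
  rw [← hmap, hxy, Sym2.map_mk] at hv
  rcases Sym2.mem_iff.1 hv with rfl | rfl
  · exact ⟨y₁, hy₁, rfl⟩
  · exact ⟨y₂, hy₂, rfl⟩

omit [IsStrictOrderedRing R] in
/-- **Row 2′TRI on a typed graph with one unmarked star vertex over an all-marked base**, from the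
`K₅` star statement at the image marking. -/
theorem typedCount_K3_nonneg_of_starNonneg {V : Type*} {E : Type*} [Fintype E] [DecidableEq E]
    [DecidableEq V] (m : V → Fin 5) (ends : E → Sym2 V) (F : Finset E) {M : Set V}
    (hinj : Set.InjOn m M) {u v₁ v₂ v₃ : V} {e₁ e₂ e₃ : E} (hd : StarData ends M u v₁ v₂ v₃ e₁ e₂ e₃)
    (he₁ : e₁ ∈ F) (he₂ : e₂ ∈ F) (he₃ : e₃ ∈ F)
    (hM : ∀ e ∈ ((F.erase e₁).erase e₂).erase e₃, ∀ v ∈ ends e, v ∈ M)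
    (hloop : ∀ e ∈ ((F.erase e₁).erase e₂).erase e₃, ¬ (ends e).IsDiag)
    (hpar : ∀ e ∈ ((F.erase e₁).erase e₂).erase e₃, ∀ e' ∈ ((F.erase e₁).erase e₂).erase e₃,
      ends e = ends e' → e = e')
    {o a₁ a₂ a₃ b : V} (ho : o ∈ M) (ha₁ : a₁ ∈ M) (ha₂ : a₂ ∈ M) (ha₃ : a₃ ∈ M) (hb : b ∈ M)
    (hMk : ∀ v ∈ M, v = o ∨ v = a₁ ∨ v = a₂ ∨ v = a₃ ∨ v = b) (τ : E → ℕ)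
    (hS : StarNonneg R (m o) (m a₁) (m a₂) (m a₃) (m b) (m v₁) (m v₂) (m v₃) (τ e₁) (τ e₂) (τ e₃)) :
    0 ≤ typedCount F (fun _ => false) τ (CovForm.K3 (R := R) ends o a₁ a₂ a₃ b) := by
  rw [typedCount_K3_star m ends F hinj hd he₁ he₂ he₃ hM hloop hpar ho ha₁ ha₂ ha₃ hb τ]
  refine hS _ _ fun j hj v hv => ?_
  obtain ⟨y, hy, rfl⟩ := minorFM_ends m ends _ hM hj v hv
  rcases hMk y hy with rfl | rfl | rfl | rfl | rfl
  · exact Or.inl rfl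
  · exact Or.inr (Or.inl rfl)
  · exact Or.inr (Or.inr (Or.inl rfl))
  · exact Or.inr (Or.inr (Or.inr (Or.inl rfl)))
  · exact Or.inr (Or.inr (Or.inr (Or.inr rfl)))

end Statement

end K5

end Summit.Ventures.PercRepro2
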